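import Mathlib
import Summits.Ventures.PercRepro2.Defs
import Summits.Ventures.PercRepro2.Harris
import Summits.Ventures.PercRepro2.Graph
import Summits.Ventures.PercRepro2.Events
import Summits.Ventures.PercRepro2.Induced
import Summits.Ventures.PercRepro2.SameClusterAvoid
import Summits.Ventures.PercRepro2.CCTRootEdge
import Summits.Ventures.PercRepro2.CCTAvoidedEdge

/-!
# The one-root drop `P(a ↔ b) − P(a ↔ b | a ↮ v)` grows with every edge at `v`
(blind cell PercRepro2, mine-c g28; `conjectures/MINE-C.md` §37.10, the one-root case of (C-MONO))

For a root `a`, a mark `b` and a vertex `v`, with an edge `e = {v, y}` at `v` of weight `t`: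

  `drop p = P_p(a ↔ b) − P_p(a ↔ b, a ↮ v) / P_p(a ↮ v)`

is non-decreasing in `t` (Lean's `x / 0 = 0` convention at a null `{a ↮ v}`).  Proof: condition on the
status of `e`.  With `e` open, `a ↮ v` forces `a ↮ y` in `G − e` and `a ↔ b` cannot use `e`
(`update_true_mem_avoid_iff`, `update_true_mem_conn_avoid_iff`), so the conditional probability
`P_t(a ↔ b | a ↮ v)` is a mixture of `P₀(a ↔ b | a ↮ v)` and `P₀(a ↔ b | a ↮ v, a ↮ y)` with the weight
on the second non-decreasing in `t`; the second is the smaller by BHK06 Theorem 1.3 (the cluster of `a`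
is positively associated given `a ↮ v`: `bhk_same_cluster_events_avoid`), so the conditional
probability is non-increasing, while `P_t(a ↔ b)` is non-decreasing (`prob_mono`).  The lens's
(C-MONO) — the same statement with two roots `a₁ ↮ a₂` and `σ_b` — is the census-true candidate;
this file is its one-root case.
-/

namespace Summit.Ventures.PercRepro2

namespace OneRootDrop

variable {V : Type*} {E : Type*} [Fintype V] [DecidableEq V] [Fintype E] [DecidableEq E]
  {R : Type*} [Field R] [LinearOrder R] [IsStrictOrderedRing R]

/-- The drop of the connection probability `a ↔ b` under the conditioning `a ↮ v`:
`P(a ↔ b) − P(a ↔ b, a ↮ v) / P(a ↮ v)` (`x / 0 = 0` when `{a ↮ v}` is null). -/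
noncomputable def drop (p : E → R) (ends : E → Sym2 V) (a b v : V) : R :=
  prob p (connEvent ends a b) -
    prob p (connEvent ends a b ∩ avoidAll ends a {v}) / prob p (avoidAll ends a {v})

section Pinned

variable {ends : E → Sym2 V} {e : E} {v y : V}

omit [Fintype V] [DecidableEq V] [Fintype E] in
/-- With `e = {v, y}` open, `a ↮ v` iff (with `e` closed) `a ↮ v` and `a ↮ y`. -/
lemma update_true_mem_avoid_iff (hends : ends e = s(v, y)) (ω : Config E) (a : V) :
    Function.update ω e true ∈ avoidAll ends a {v} ↔
      Function.update ω e false ∈ avoidAll ends a {v} ∧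
        Function.update ω e false ∈ avoidAll ends a {y} := by
  simp only [avoidAll, Set.mem_setOf_eq, Finset.mem_singleton, forall_eq]
  have hcl := CCT.cluster_update_true_eq hends ω
  have key : Conn ends (Function.update ω e true) v a ↔
      Conn ends (Function.update ω e false) v a ∨ Conn ends (Function.update ω e false) y a := by
    rw [← mem_cluster, hcl, Set.mem_union, mem_cluster, mem_cluster]
  constructor
  · intro h
    have h' : ¬ (Conn ends (Function.update ω e false) v a ∨
        Conn ends (Function.update ω e false) y a) := by
      rw [← key]; exact fun hc => h (conn_symm hc)
    exact ⟨fun hc => h' (Or.inl (conn_symm hc)), fun hc => h' (Or.inr (conn_symm hc))⟩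
  · rintro ⟨h1, h2⟩ hc
    rcases key.1 (conn_symm hc) with h | h
    · exact h1 (conn_symm h)
    · exact h2 (conn_symm h)

omit [Fintype V] [DecidableEq V] [Fintype E] in
/-- With `e = {v, y}` open, `a ↔ b ∧ a ↮ v` iff (with `e` closed) `a ↔ b ∧ a ↮ v ∧ a ↮ y`:
a path from `a` to `b` avoiding `v` cannot use `e`. -/
lemma update_true_mem_conn_avoid_iff (hends : ends e = s(v, y)) (ω : Config E) (a b : V) :
    Function.update ω e true ∈ connEvent ends a b ∩ avoidAll ends a {v} ↔
      Function.update ω e false ∈ connEvent ends a b ∩ avoidAll ends a {v} ∩ avoidAll ends a {y} := by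
  have hav := update_true_mem_avoid_iff hends ω a
  constructor
  · rintro ⟨hb, hv⟩
    have h2 := hav.1 hv
    have hcl : cluster ends (Function.update ω e true) a =
        cluster ends (Function.update ω e false) a :=
      CCT.cluster_update_true_eq_of_not_touch ends hends ω a
        (by rw [mem_cluster]; exact h2.1 v (Finset.mem_singleton_self v))
        (by rw [mem_cluster]; exact h2.2 y (Finset.mem_singleton_self y))
    refine ⟨⟨?_, h2.1⟩, h2.2⟩
    rw [mem_connEvent, ← mem_cluster, ← hcl, mem_cluster]
    exact hb
  · rintro ⟨⟨hb, hv⟩, hy⟩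
    have hcl : cluster ends (Function.update ω e true) a =
        cluster ends (Function.update ω e false) a :=
      CCT.cluster_update_true_eq_of_not_touch ends hends ω a
        (by rw [mem_cluster]; exact hv v (Finset.mem_singleton_self v))
        (by rw [mem_cluster]; exact hy y (Finset.mem_singleton_self y))
    refine ⟨?_, hav.2 ⟨hv, hy⟩⟩
    rw [mem_connEvent, ← mem_cluster, hcl, mem_cluster]
    exact hb

variable (p : E → R)

omit [Fintype V] [DecidableEq V] [LinearOrder R] [IsStrictOrderedRing R] in
/-- `P₁(a ↮ v) = P₀(a ↮ v, a ↮ y)`. -/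
lemma prob_one_avoid (hends : ends e = s(v, y)) (a : V) :
    prob (Function.update p e 1) (avoidAll ends a {v}) =
      prob (Function.update p e 0) (avoidAll ends a {v} ∩ avoidAll ends a {y}) := by
  rw [CCT.prob_update_one_eq, CCT.prob_update_zero_eq]
  congr 1
  ext ω
  simp only [Set.mem_setOf_eq, Set.mem_inter_iff]
  exact update_true_mem_avoid_iff hends ω a

omit [Fintype V] [DecidableEq V] [LinearOrder R] [IsStrictOrderedRing R] in
/-- `P₁(a ↔ b, a ↮ v) = P₀(a ↔ b, a ↮ v, a ↮ y)`. -/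
lemma prob_one_conn_avoid (hends : ends e = s(v, y)) (a b : V) :
    prob (Function.update p e 1) (connEvent ends a b ∩ avoidAll ends a {v}) =
      prob (Function.update p e 0)
        (connEvent ends a b ∩ avoidAll ends a {v} ∩ avoidAll ends a {y}) := by
  rw [CCT.prob_update_one_eq, CCT.prob_update_zero_eq]
  congr 1
  ext ω
  simp only [Set.mem_setOf_eq]
  exact update_true_mem_conn_avoid_iff hends ω a b

omit [Fintype V] [DecidableEq V] in
/-- Opening `e` can only help `a ↔ b`: `P₀(a ↔ b) ≤ P₁(a ↔ b)`. -/
lemma prob_zero_conn_le_one (hp : IsProbVec p) (a b : V) :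
    prob (Function.update p e 0) (connEvent ends a b) ≤
      prob (Function.update p e 1) (connEvent ends a b) := by
  rw [CCT.prob_update_one_eq, CCT.prob_update_zero_eq]
  refine prob_mono hp fun ω hω => ?_
  simp only [Set.mem_setOf_eq, mem_connEvent] at hω ⊢
  exact conn_mono (update_false_le_update_true ω e) hω

omit [Fintype V] [DecidableEq V] [LinearOrder R] [IsStrictOrderedRing R] in
/-- Pinning: `P_{p[e↦t]}(A) = t · P₁(A) + (1 − t) · P₀(A)`. -/
lemma prob_update_eq_pin (t : R) (A : Set (Config E)) :
    prob (Function.update p e t) A =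
      t * prob (Function.update p e 1) A + (1 - t) * prob (Function.update p e 0) A := by
  rw [prob_eq_pin (Function.update p e t) A e]
  simp only [Function.update_self, Function.update_idem]

end Pinned

section BHK

variable (p : E → R) (ends : E → Sym2 V) (a b y v : V)

/-- **BHK06 Thm 1.3 at the pinned weights, complement form**: with `Rv = {a ↮ v}`, `Y = {a ↔ y}`,
`B = {a ↔ b}`: `P(B ∩ Rv ∩ Yᶜ) · P(Rv) ≤ P(B ∩ Rv) · P(Rv ∩ Yᶜ)` — conditioning on `y ∉ C(a)`
lowers `P(b ∈ C(a))` given `a ↮ v`. -/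
lemma bhk_complement_form (hp : IsProbVec p) :
    prob p (connEvent ends a b ∩ avoidAll ends a {v} ∩ avoidAll ends a {y}) *
        prob p (avoidAll ends a {v}) ≤
      prob p (connEvent ends a b ∩ avoidAll ends a {v}) *
        prob p (avoidAll ends a {v} ∩ avoidAll ends a {y}) := by
  -- the up-sets `{S ∣ b ∈ S}` and `{S ∣ y ∈ S}`
  have hU : IsUpperSet {S : Set V | b ∈ S} := fun _ _ hST h => hST h
  have hY : IsUpperSet {S : Set V | y ∈ S} := fun _ _ hST h => hST h
  have key := bhk_same_cluster_events_avoid p hp ends a ({v} : Finset V) hU hY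
  have e1 : clusterInEvent ends a {S : Set V | b ∈ S} = connEvent ends a b := by
    ext ω; simp only [mem_clusterInEvent, Set.mem_setOf_eq, mem_cluster, mem_connEvent]
  have e2 : clusterInEvent ends a {S : Set V | y ∈ S} = connEvent ends a y := by
    ext ω; simp only [mem_clusterInEvent, Set.mem_setOf_eq, mem_cluster, mem_connEvent]
  have e3 : clusterInEvent ends a ({S : Set V | b ∈ S} ∩ {S : Set V | y ∈ S}) =
      connEvent ends a b ∩ connEvent ends a y := by
    ext ω
    simp only [mem_clusterInEvent, Set.mem_inter_iff, Set.mem_setOf_eq, mem_cluster, mem_connEvent]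
  rw [e1, e2, e3] at key
  -- `avoidAll a {y} = (connEvent a y)ᶜ`
  have ey : avoidAll ends a {y} = (connEvent ends a y)ᶜ := by
    ext ω
    simp only [avoidAll, Set.mem_setOf_eq, Finset.mem_singleton, forall_eq, Set.mem_compl_iff,
      mem_connEvent]
  set B := connEvent ends a b with hB
  set Y := connEvent ends a y with hYdef
  set Rv := avoidAll ends a {v} with hRv
  -- the two complement splits
  have s1 := prob_inter_add_prob_inter_compl p (B ∩ Rv) Y
  have s2 := prob_inter_add_prob_inter_compl p Rv Y
  have c1 : B ∩ Rv ∩ avoidAll ends a {y} = B ∩ Rv ∩ Yᶜ := by rw [ey]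
  have c2 : Rv ∩ avoidAll ends a {y} = Rv ∩ Yᶜ := by rw [ey]
  rw [c1, c2]
  -- `key : P(B ∩ Rv) · P(Y ∩ Rv) ≤ P((B ∩ Y) ∩ Rv) · P(Rv)`
  have k1 : Y ∩ Rv = Rv ∩ Y := Set.inter_comm _ _
  have k2 : B ∩ Y ∩ Rv = B ∩ Rv ∩ Y := by
    ext ω; simp only [Set.mem_inter_iff]; tauto
  rw [k1, k2] at key
  nlinarith [key, s1, s2, prob_nonneg hp (B ∩ Rv), prob_nonneg hp Rv,
    prob_nonneg hp (B ∩ Rv ∩ Y), prob_nonneg hp (Rv ∩ Y), prob_nonneg hp (B ∩ Rv ∩ Yᶜ),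
    prob_nonneg hp (Rv ∩ Yᶜ)]

end BHK

section Main

variable (p : E → R) (ends : E → Sym2 V) {e : E} {v y : V}

/-- The ratio `P_t(B ∩ Rv) / P_t(Rv)` is non-increasing in the weight `t` of `e = {v, y}`. -/
lemma ratio_antitone (hp : IsProbVec p) (hends : ends e = s(v, y)) (a b : V) {s t : R}
    (hs : 0 ≤ s) (hst : s ≤ t) (ht : t ≤ 1) :
    prob (Function.update p e t) (connEvent ends a b ∩ avoidAll ends a {v}) /
        prob (Function.update p e t) (avoidAll ends a {v}) ≤
      prob (Function.update p e s) (connEvent ends a b ∩ avoidAll ends a {v}) /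
        prob (Function.update p e s) (avoidAll ends a {v}) := by
  have hp₀ : IsProbVec (Function.update p e 0) := hp.update e le_rfl zero_le_one
  set B := connEvent ends a b with hB
  set Rv := avoidAll ends a {v} with hRv
  set Ry := avoidAll ends a {y} with hRy
  -- the four pinned masses
  set ε := prob (Function.update p e 0) Rv with hε
  set ε' := prob (Function.update p e 0) (Rv ∩ Ry) with hε'
  set γ := prob (Function.update p e 0) (B ∩ Rv) with hγ
  set γ' := prob (Function.update p e 0) (B ∩ Rv ∩ Ry) with hγ'
  have h1 : prob (Function.update p e 1) Rv = ε' := prob_one_avoid p hends a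
  have h2 : prob (Function.update p e 1) (B ∩ Rv) = γ' := prob_one_conn_avoid p hends a b
  have hbhk : γ' * ε ≤ γ * ε' := bhk_complement_form (Function.update p e 0) ends a b y v hp₀
  have hε0 : 0 ≤ ε := prob_nonneg hp₀ _
  have hε'0 : 0 ≤ ε' := prob_nonneg hp₀ _
  have hγ0 : 0 ≤ γ := prob_nonneg hp₀ _
  have hγ'0 : 0 ≤ γ' := prob_nonneg hp₀ _
  have hε'ε : ε' ≤ ε := prob_mono hp₀ Set.inter_subset_left
  have hγ'γ : γ' ≤ γ := prob_mono hp₀ Set.inter_subset_left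
  rw [prob_update_eq_pin p t (B ∩ Rv), prob_update_eq_pin p t Rv, prob_update_eq_pin p s (B ∩ Rv),
    prob_update_eq_pin p s Rv, h1, h2]
  -- the denominators: `Ds − Dt = (t − s)(ε − ε') ≥ 0`
  set Dt := t * ε' + (1 - t) * ε with hDt
  set Ds := s * ε' + (1 - s) * ε with hDs
  have hDt0 : 0 ≤ Dt := by
    have := mul_nonneg (le_trans hs hst) hε'0
    have := mul_nonneg (sub_nonneg.2 ht) hε0
    linarith
  have hDsDt : Dt ≤ Ds := by
    have : 0 ≤ (t - s) * (ε - ε') := mul_nonneg (sub_nonneg.2 hst) (sub_nonneg.2 hε'ε)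
    have : Ds - Dt = (t - s) * (ε - ε') := by rw [hDs, hDt]; ring
    linarith
  have hDs0 : 0 ≤ Ds := le_trans hDt0 hDsDt
  have hNs0 : 0 ≤ s * γ' + (1 - s) * γ := by
    have := mul_nonneg hs hγ'0
    have := mul_nonneg (sub_nonneg.2 (le_trans hst ht)) hγ0
    linarith
  rcases eq_or_lt_of_le hDt0 with hDtz | hDtpos
  · -- `P_t(Rv) = 0`: the left ratio is `0`, the right one is `≥ 0`
    rw [← hDtz, div_zero]
    exact div_nonneg hNs0 hDs0
  · have hDspos : 0 < Ds := lt_of_lt_of_le hDtpos hDsDt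
    rw [div_le_div_iff₀ hDtpos hDspos]
    -- `(t γ' + (1 − t) γ) Ds ≤ (s γ' + (1 − s) γ) Dt ⟺ (t − s)(γ' ε − γ ε') ≤ 0`
    have : (t * γ' + (1 - t) * γ) * Ds - (s * γ' + (1 - s) * γ) * Dt =
        (t - s) * (γ' * ε - γ * ε') := by
      rw [hDs, hDt]; ring
    nlinarith [mul_nonneg (sub_nonneg.2 hst) (sub_nonneg.2 hbhk)]

/-- **The one-root drop theorem**: `drop p[e↦t] = P_t(a ↔ b) − P_t(a ↔ b | a ↮ v)` is
non-decreasing in the weight `t ∈ [0, 1]` of an edge `e = {v, y}` at `v`. -/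
theorem drop_mono (hp : IsProbVec p) (hends : ends e = s(v, y)) (a b : V) {s t : R}
    (hs : 0 ≤ s) (hst : s ≤ t) (ht : t ≤ 1) :
    drop (Function.update p e s) ends a b v ≤ drop (Function.update p e t) ends a b v := by
  unfold drop
  have hr := ratio_antitone p ends hp hends a b hs hst ht
  have hB : prob (Function.update p e s) (connEvent ends a b) ≤
      prob (Function.update p e t) (connEvent ends a b) := by
    rw [prob_update_eq_pin p s (connEvent ends a b), prob_update_eq_pin p t (connEvent ends a b)]
    have h01 := prob_zero_conn_le_one p hp (e := e) (ends := ends) a b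
    nlinarith [mul_nonneg (sub_nonneg.2 hst) (sub_nonneg.2 h01)]
  linarith

end Main

end OneRootDrop

end Summit.Ventures.PercRepro2
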